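import Mathlib
import Summits.ValiantsHypothesis.ValiantsHypothesis.Theorems.FreeSubtorusOrbitDimensionBoundStubKernelCyclePrelim
import Summits.ValiantsHypothesis.ValiantsHypothesis.Theorems.FreeSubtorusConfusionCoveringLeibnizExtract
import Summits.ValiantsHypothesis.ValiantsHypothesis.Theorems.FreeSubtorusOrbitDimensionBoundStubSignDiagonalise
import Summits.ValiantsHypothesis.ValiantsHypothesis.Theorems.FreeSubtorusSubtorusCovering
import Literature.Computability.AlgebraicComplexity.LRPencilOfMatrix
import Literature.Computability.AlgebraicComplexity.LandsbergRessayreNormalForm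
import Literature.Computability.AlgebraicComplexity.StandardFamilies

/-!
# `OrbitDimensionBound` (stmt-ValiantsHypothesis-16133), rung line `no_minor_covering` — stub `stub_kernelCycle` (the CORE)

The line `Cruxes/OrbitDimensionBound/Lines/no_minor_covering.lean` registers three stubs; `stub_genericElementNoMinor`
(p600558) and `stub_gradedNormalForm` (p606037) are LANDED; this file proves the third and load-bearing one (statement =
the line's, l.115, token for token; `constPart`, `coeffMat`, `perPoly` are the tree's Literature vocabulary):

for an affine `A'` with `det A' = κ·per_n` in graded normal form (constant part `diag(j ↦ [j ≠ j₀])`, `β = α` off `j₀`,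
`x_p`-entries only from column weight `α_j` to row weight `β_i = c_p α_j`, `α ≠ 0`, `α_{j₀} = γ₀`) and a permutation `σ`
with NO non-empty proper row set `M` of weight product `∏_{k ∈ M} c_{k σ k} = 1`, every `1 ≤ i ≤ n` is read by the
kernel cycle: some `i`-set `I` of rows and some index `i'` have `β_{i'} = γ₀ ∏_{k ∈ I} c_{k σ k}`.

**Proof.**  Substitute the `y`-weighted permutation matrix of `σ` (`x_{kl} ↦ [l = σ k]·y_k`, an algebra map
`ℂ[x] → ℂ[y]`): the image `M` of `A'` is affine in `y` with `det M = κ · per_n(weighted σ) = κ · ∏_k y_k`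
(`aeval_perPoly_weightedPerm`), so the square-free monomial `∏ y_k` has a non-zero coefficient and the tree's Leibniz
extraction (`exists_perm_embedding_of_coeff_det_ne_zero`) yields `π ∈ 𝔖_m`, `τ : [n] ↪ [m]` with: the `y_k`-coefficient of
`M_{π(τk), τk}` — which is `coeffMat A' (k, σ k)` (`coeff_aeval_weightedPerm`) — is non-zero, so `β_{π τ k} = c_{kσk} α_{τ k}`;
and off `range τ` the constant coefficient of `M_{πj, j}` — `[π j = j ≠ j₀]` — is non-zero, so `π` fixes the complement of
`range τ` and `j₀ ∈ range τ`.  The combinatorial core `KernelCycle.kernelCycle_comb` (part A, p606186: every `π`-invariant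
set of variable columns avoiding `j₀` is empty by telescoping + the no-minor hypothesis, so the `π`-orbit of `j₀` is all of
`range τ` and the weights telescope along it) finishes.

Helper mode (`--supports stmt-ValiantsHypothesis-16133 --as helper`): the item's registered skeleton is `affine_multiple`; no
stub credit moves.  Honest framing: with this file ALL THREE stubs of the dormant rung line `no_minor_covering` are theorems
in `Theorems/` (exact-wiring of `Lines/no_minor_covering.lean` is a planner act); the rung `NoMinorCovering` is a FORWARD
rung, not the crux; `OrbitDimensionBound`, the route `FreeSubtorus` and VP ≠ VNP are OPEN and NOT moved by this file.

## References
* [LandsbergRessayre2017] J. M. Landsberg, N. Ressayre, *Permanent v. determinant: an exponential lower bound assuming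
  symmetry and a potential path towards Valiant's conjecture*, Differential Geom. Appl. 55 (2017), §6.
-/

open Matrix MvPolynomial Finset
open Literature.Computability.AlgebraicComplexity LRPencil
open Summit.ValiantsHypothesis.ValiantsHypothesis.Theorems.FreeSubtorusConfusionCovering
  (exists_perm_embedding_of_coeff_det_ne_zero)
open Summit.ValiantsHypothesis.ValiantsHypothesis.Theorems.FreeSubtorusOrbitDimensionBound.SignCovering
  (eq_C_add_sum_smul_X_of_totalDegree_le_one)
open Summit.ValiantsHypothesis.ValiantsHypothesis.Theorems.FreeSubtorusSubtorusCovering (totalDegree_aeval_le_one)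

-- the mandated summit-side namespace repeats a component by design (single-problem summit)
set_option linter.dupNamespace false

namespace Summit.ValiantsHypothesis.ValiantsHypothesis.Theorems.FreeSubtorusOrbitDimensionBound.KernelCycle

noncomputable section

variable {n : ℕ}

/-! ### §1 The weighted permutation substitution `x_{kl} ↦ [l = σ k] · y_k` -/

/-- The substituted variables are affine. [folklore] -/
theorem totalDegree_weightedPerm_le (σ : Equiv.Perm (Fin n)) (p : Fin n × Fin n) :
    ((if p.2 = σ p.1 then (X p.1 : MvPolynomial (Fin n) ℂ) else 0)).totalDegree ≤ 1 := by
  split_ifs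
  · exact (totalDegree_X _).le
  · simp

/-- `∏_{k ∈ s} y_k = monomial (Σ_{k∈s} e_k) 1`. [folklore] -/
theorem prod_X_eq_monomial_finset (s : Finset (Fin n)) :
    (∏ k ∈ s, (X k : MvPolynomial (Fin n) ℂ)) = monomial (∑ k ∈ s, Finsupp.single k 1) 1 := by
  classical
  induction s using Finset.induction_on with
  | empty => simp
  | insert a s ha ih =>
    rw [Finset.prod_insert ha, Finset.sum_insert ha, ih]
    show monomial (Finsupp.single a 1) (1 : ℂ) * monomial (∑ k ∈ s, Finsupp.single k 1) 1 = _
    rw [monomial_mul, one_mul]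

/-- The square-free monomial `∏_k y_k` is `monomial (Σ_k e_k) 1`. [folklore] -/
theorem prod_X_eq_monomial :
    (∏ k : Fin n, (X k : MvPolynomial (Fin n) ℂ)) = monomial (∑ k : Fin n, Finsupp.single k 1) 1 :=
  prod_X_eq_monomial_finset Finset.univ

/-- The permanent of the weighted permutation matrix of `σ`: `per_n (x_{kl} ↦ [l = σ k] y_k) = ∏_k y_k`. [folklore] -/
theorem aeval_perPoly_weightedPerm (σ : Equiv.Perm (Fin n)) :
    MvPolynomial.aeval (fun p : Fin n × Fin n => if p.2 = σ p.1 then (X p.1 : MvPolynomial (Fin n) ℂ) else 0)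
        (perPoly (Fin n) ℂ) = ∏ k : Fin n, X k := by
  classical
  simp only [perPoly, Matrix.permanent, map_sum, map_prod, Matrix.mvPolynomialX_apply, aeval_X]
  rw [Finset.sum_eq_single σ.symm]
  · -- the term `π' = σ⁻¹`
    rw [← Equiv.prod_comp σ.symm (fun k : Fin n => (X k : MvPolynomial (Fin n) ℂ))]
    refine Finset.prod_congr rfl fun i _ => ?_
    rw [if_pos (σ.apply_symm_apply i).symm]
  · -- the other permutations contribute `0`
    intro π' _ hπ'
    obtain ⟨i, hi⟩ : ∃ i, ¬ (i = σ (π' i)) := by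
      by_contra h
      push Not at h
      apply hπ'
      exact Equiv.ext fun i => ((σ.symm_apply_eq).mpr (h i)).symm
    exact Finset.prod_eq_zero (Finset.mem_univ i) (if_neg hi)
  · intro h; exact absurd (Finset.mem_univ _) h

/-- Coefficients of the substituted affine entry: the `y_k`-coefficient is the `x_{k σ k}`-coefficient and the constant
coefficient is unchanged. [folklore] -/
theorem coeff_aeval_weightedPerm (σ : Equiv.Perm (Fin n)) (f : MvPolynomial (Fin n × Fin n) ℂ) (hf : f.totalDegree ≤ 1) :
    (∀ k, coeff (Finsupp.single k 1)
        (MvPolynomial.aeval (fun p : Fin n × Fin n => if p.2 = σ p.1 then (X p.1 : MvPolynomial (Fin n) ℂ) else 0) f) =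
      coeff (Finsupp.single (k, σ k) 1) f) ∧
    coeff 0 (MvPolynomial.aeval (fun p : Fin n × Fin n => if p.2 = σ p.1 then (X p.1 : MvPolynomial (Fin n) ℂ) else 0) f) =
      coeff 0 f := by
  classical
  set φ : MvPolynomial (Fin n × Fin n) ℂ →ₐ[ℂ] MvPolynomial (Fin n) ℂ :=
    MvPolynomial.aeval (fun p : Fin n × Fin n => if p.2 = σ p.1 then (X p.1 : MvPolynomial (Fin n) ℂ) else 0) with hφ
  -- the image of the affine expansion
  have hexp : φ f = C (coeff 0 f) + ∑ k : Fin n, monomial (Finsupp.single k 1) (coeff (Finsupp.single (k, σ k) 1) f) := by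
    conv_lhs => rw [eq_C_add_sum_smul_X_of_totalDegree_le_one hf]
    rw [map_add, algHom_C, map_sum]
    congr 1
    simp only [map_smul, hφ, aeval_X, smul_ite, smul_zero]
    rw [Fintype.sum_prod_type]
    refine Finset.sum_congr rfl fun k _ => ?_
    rw [Finset.sum_ite_eq' Finset.univ (σ k), if_pos (Finset.mem_univ _), smul_eq_C_mul, C_mul_X_eq_monomial]
  refine ⟨fun k => ?_, ?_⟩
  · rw [hexp, coeff_add, coeff_C, if_neg (Finsupp.single_ne_zero.mpr one_ne_zero).symm, zero_add, coeff_sum,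
      Finset.sum_eq_single k]
    · rw [coeff_monomial, if_pos rfl]
    · intro k' _ hk'
      rw [coeff_monomial, if_neg]
      intro h
      exact hk' (Finsupp.single_left_injective one_ne_zero h)
    · intro h; exact absurd (Finset.mem_univ _) h
  · rw [hexp, coeff_add, coeff_C, if_pos rfl, coeff_sum, Finset.sum_eq_zero, add_zero]
    intro k _
    rw [coeff_monomial, if_neg (Finsupp.single_ne_zero.mpr one_ne_zero)]

/-! ### §2 The stub -/

/-- **Stub `stub_kernelCycle` of the line `no_minor_covering`** (statement = the line's, l.115): the kernel cycle reads the
whole permutation. [cite: LandsbergRessayre2017, §6] -/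
theorem stub_kernelCycle :
    ∀ (n m : ℕ) (A' : Matrix (Fin m) (Fin m) (MvPolynomial (Fin n × Fin n) ℂ)) (c : Fin n × Fin n → ℂ)
    (α β : Fin m → ℂ) (j₀ : Fin m) (γ₀ κ : ℂ),
    κ ≠ 0 → (∀ p, c p ≠ 0) → (∀ j, α j ≠ 0) →
    (∀ i j, (A' i j).totalDegree ≤ 1) →
    A'.det = C κ * perPoly (Fin n) ℂ →
    constPart A' = Matrix.diagonal (fun j => if j = j₀ then (0 : ℂ) else 1) →
    (∀ j, j ≠ j₀ → β j = α j) →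
    (∀ (p : Fin n × Fin n) (i j : Fin m), coeffMat A' p i j ≠ 0 → β i = c p * α j) →
    α j₀ = γ₀ →
    ∀ σ : Equiv.Perm (Fin n),
    (∀ M : Finset (Fin n), M.Nonempty → M ≠ Finset.univ → (∏ k ∈ M, c (k, σ k)) ≠ 1) →
    ∀ i : ℕ, 1 ≤ i → i ≤ n →
      ∃ I : Finset (Fin n), I.card = i ∧ ∃ i' : Fin m, β i' = γ₀ * ∏ k ∈ I, c (k, σ k) := by
  intro n m A' c α β j₀ γ₀ κ hκ _hc hα haff hdet hconst hβα hgr hαj₀ σ hσ i hi1 hin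
  classical
  -- §1: substitute the weighted permutation matrix of `σ`
  set gσ : Fin n × Fin n → MvPolynomial (Fin n) ℂ := fun p => if p.2 = σ p.1 then X p.1 else 0 with hgσ
  set φ : MvPolynomial (Fin n × Fin n) ℂ →ₐ[ℂ] MvPolynomial (Fin n) ℂ := MvPolynomial.aeval gσ with hφ
  set M : Matrix (Fin m) (Fin m) (MvPolynomial (Fin n) ℂ) := A'.map φ with hM
  have hMaff : ∀ i j, (M i j).totalDegree ≤ 1 := fun i j =>
    totalDegree_aeval_le_one gσ (totalDegree_weightedPerm_le σ) _ (haff i j)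
  have hdetM : M.det = C κ * ∏ k : Fin n, X k := by
    rw [hM, ← AlgHom.mapMatrix_apply, ← AlgHom.map_det, hdet, map_mul, algHom_C, hφ, hgσ, aeval_perPoly_weightedPerm]
    rfl
  have hcoeff : coeff (∑ k : Fin n, Finsupp.single k 1) M.det ≠ 0 := by
    rw [hdetM, prod_X_eq_monomial, coeff_C_mul, coeff_monomial, if_pos rfl, mul_one]
    exact hκ
  obtain ⟨π, τ, ha, hb⟩ := exists_perm_embedding_of_coeff_det_ne_zero M hMaff hcoeff
  -- reading the entries
  have hcoef : ∀ i j, (∀ k, coeff (Finsupp.single k 1) (M i j) = coeffMat A' (k, σ k) i j) ∧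
      coeff 0 (M i j) = constPart A' i j := by
    intro i j
    obtain ⟨h1, h2⟩ := coeff_aeval_weightedPerm σ (A' i j) (haff i j)
    refine ⟨fun k => ?_, ?_⟩
    · rw [hM, Matrix.map_apply, coeffMat_apply]; exact h1 k
    · rw [hM, Matrix.map_apply, constPart_apply, constantCoeff_eq]; exact h2
  -- (F2) the grading relations along `π ∘ τ`
  have hF2 : ∀ k, β (π (τ k)) = c (k, σ k) * α (τ k) := by
    intro k
    refine hgr (k, σ k) _ _ ?_
    rw [← (hcoef _ _).1 k]
    exact ha k
  -- (F3) `π` fixes the columns off `range τ`, and `j₀ ∈ range τ`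
  have hdiag : ∀ j, j ∉ Set.range τ → π j = j ∧ j ≠ j₀ := by
    intro j hj
    have h := hb j hj
    rw [(hcoef _ _).2, hconst, Matrix.diagonal_apply] at h
    by_cases hπ : π j = j
    · rw [if_pos hπ, hπ] at h
      refine ⟨hπ, fun hj₀ => h ?_⟩
      rw [if_pos hj₀]
    · exact absurd (if_neg hπ) h
  have hF3 : ∀ j, j ∉ Set.range τ → π j = j := fun j hj => (hdiag j hj).1
  have hj₀ : j₀ ∈ Set.range τ := by
    by_contra h
    exact (hdiag j₀ h).2 rfl
  -- §2: the combinatorial core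
  obtain ⟨I, hI, i', h⟩ := kernelCycle_comb π τ j₀ α β (fun k => c (k, σ k)) hα hβα hF2 hF3 hj₀ hσ i hi1 hin
  exact ⟨I, hI, i', by rw [h, hαj₀]⟩

end

end Summit.ValiantsHypothesis.ValiantsHypothesis.Theorems.FreeSubtorusOrbitDimensionBound.KernelCycle
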